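import Summits.CriticalPhenomena.CardyFormulaZ2.Theses.CardyPolygonWords
import Literature.Probability.LatticeModels.PercolationPolygonWordProofs

/-!
# Birth skeleton (BC3) for crux `WordSewing` (stmt-CriticalPhenomena-14409)

Route `CardyPolygonWords` of `CardyFormulaZ2`, crux r4 (the glue crux of the route-choice repair):

  `WordSewing := CardyRectangle → CardyOneStep → CardyLatticePolygon`

— Cardy's formula (G02 discretisation `bondDomainCrossingProb`, bond-`ℤ²`, `p = 1/2`) for
corner-marked RECTANGLES (words of length one `⟨β|T_S^m|α⟩`) and for corner-marked ONE-STEP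
polygons (one junction letter) implies it for EVERY marked lattice polygon (polyomino Jordan
domain of `δ₀`-squares, four marks at `δ₀`-lattice points).

## The line (aligned word limits; wire letters first, then width junctions by induction on blocks)

The item's own plan (S1)–(S3), cut where the word vocabulary now in the tree
(`Literature.Probability.LatticeModels.PercolationPolygonWord`: two-star row states, the
stochastic Temperley–Lieb(`β = 1`) letters `T_S`, junction letters `J`, WIRE letters, the word
amplitude `polygonWordAmplitude`, and the PROVED dictionary `RowTransferExactness_holds`:
`bondDomainCrossingProb R (δ₀/N) = polygonWordAmplitude R (δ₀/N)` at every aligned mesh) lets the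
statements be typed at the level where words are exact — the ALIGNED meshes `δ = δ₀ / N`:

* `AlignedWordCardy k` (local predicate): for every polyomino presentation `(δ₀, s)` of a conformal
  rectangle `R` with `δ₀`-lattice marks and at most `k` ROW-BLOCKS (`blockCount s ≤ k`: maximal
  runs of consecutive rows of `s` with constant column set, i.e. the word of `s` has `≤ k - 1`
  width-junction letters), the word amplitudes along the aligned meshes converge to Cardy's value:
  `polygonWordAmplitude R (δ₀/N) → cardyFunction η(R)` as `N → ∞`.
* `stub_alignedMeshReduction` (M; RSW technology, no words): aligned-mesh convergence of the G02
  crossing probabilities `bondDomainCrossingProb R (δ₀/N)` for every marked lattice polygon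
  implies `CardyLatticePolygon` (all meshes `δ → 0⁺`): exact scaling covariance of the G02
  discretisation `P_{cδ}(cR) = P_δ(R)` with `c = δ₀/(Nδ) → 1`, `N = ⌊δ₀/δ⌋`, plus Schramm–Smirnov /
  Bollobás–Riordan continuity of crossing probabilities under small dilations of a lattice polygon,
  UNIFORM in the mesh (the tree's sandwich machinery of `Theorems/CardyPolygonWordsAssembly.lean`,
  `RectilinearApproximation.*`, `discreteCrossingProb_clusterPt_mem_Ioo_holds`).
* `stub_wireSewing` (L–XL; the WIRE letters): `CardyRectangle → AlignedWordCardy 1` — from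
  corner-marked rectangles (fully wired bottom row `α`, read-out `β`: the words `⟨β|T_S^m|α⟩`) to
  lattice rectangles with ARBITRARY lattice marks (partially wired rows, wires starting/stopping on
  the vertical sides: words `⟨β_B| T''^{m₃} T'^{m₂} T^{m₁} |α_A⟩` in boundary-condition-changed
  strip transfer matrices). Continuum content: Cardy's boundary-condition-changing operator
  `φ_{1,3}` inserted on the sides of the strip (Cardy 1992; BJS 2012 §5 rectangular amplitudes with
  general boundary states); the `blockCount s ≤ 1` class is exactly the lattice rectangles.
* `stub_widthSewing` (XL; the WIDTH junctions, load-bearing): `CardyOneStep → ∀ k ≥ 1,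
  AlignedWordCardy k → AlignedWordCardy (k+1)` — one more width-junction letter `J_{S,S'}`: the
  corner-marked one-step data (the junction vertex in the boundary-visible even sector, the route's
  ONE new datum) plus all `≤ k`-block polygons with arbitrary marks (all boundary-condition sectors
  of the strips) determine the `(k+1)`-block words — junction-overlap limits with `ℓ¹` tails uniform
  in the width and the Schwarz–Christoffel composition (items 5237 `JunctionOverlapLimit`, 5275
  `StepMapVertex`).
* `WordSewing_of` (kernel-checked, no `sorry`): induction on the block count from the wire-sewn
  base (`Nat.le_induction`), the proved dictionary `RowTransferExactness_holds` to pass from word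
  amplitudes to `bondDomainCrossingProb` eventually along `N → ∞`, and the aligned-mesh reduction.

The split follows the crux's recorded "why it might fail" verbatim — general lattice marks need the
two-star WIRE letters (stub 2), Z-words with 2+ junctions need junction limits in ALL TL sectors
(stub 3), and the passage words ↔ all meshes is separate RSW bookkeeping (stub 1). No stub mentions
`CardyLatticePolygon` together with both route hypotheses, none is the crux or the summit in
costume (BC3 probes in the planner folder `bc/WordSewing_probe.lean`).

## Disproof used / negatives
No `Cruxes/WordSewing/Disproof.lean` exists (`ledger crux ls stmt-CriticalPhenomena-14409`: no
workfiles before this one), so there is no `_false_without_` obstruction to honour and no landed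
`Negative/` lemma. `ledger negatives --problem CriticalPhenomena` (11 entries, 2026-08-17): none is an
instance of a stub; `NegDegenerateArcs` stmt-0748 (refuted: no conformal rectangle has crossing
probability `0` frequently) supports non-degeneracy; `JunctionShadowing` stmt-8581 (G02 `≤`-tie rule
glues seam arcs deterministically) concerns gluing of crossing EVENTS along a seam, which no stub
does (the sewing here is of transfer-matrix words, exact by `RowTransferExactness_holds`). Refuter
evidence on the item (rattack-14409 `Redundant.lean`): `CardyOneStep → CardyRectangle`, so the
`CardyRectangle` hypothesis is redundant — harmless here (stub 2 consumes it, stub 3 consumes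
`CardyOneStep`).
-/

noncomputable section

open Set Filter Topology
open Literature.Probability.RandomPlanarGeometry
open Literature.Probability.LatticeModels (polyominoCarrier polygonWordAmplitude
  RowTransferExactness_holds)
open Literature.Probability.Percolation (bondDomainCrossingProb)
open Summit.CriticalPhenomena.CardyFormulaZ2.Theses.CardyPolygonWords

namespace Summit.CriticalPhenomena.CardyFormulaZ2.Cruxes.WordSewing.Birth

/-! ### Row-blocks of a polyomino (the number of width-junction letters of its word, plus one) -/

/-- The column set of row `j` of the square set `s ⊆ ℤ²`: `{i | (i, j) ∈ s}`. [folklore] -/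
def rowColumns (s : Finset (ℤ × ℤ)) (j : ℤ) : Finset ℤ :=
  (s.filter fun p => p.2 = j).image Prod.fst

/-- **Block count** of the square set `s`: the number of occupied rows `j` whose column set differs
from that of the row `j + 1` above — the number of maximal runs of consecutive rows with constant
column set (a rectangle has block count `1`, a one-step polygon `2`; the word of `s` has
`blockCount s - 1` width-junction letters). [folklore] -/
def blockCount (s : Finset (ℤ × ℤ)) : ℕ :=
  ((s.image Prod.snd).filter fun j => rowColumns s (j + 1) ≠ rowColumns s j).card

/-- Sanity: a `2 × 2` lattice square has one block. [folklore] -/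
example : blockCount {(0, 0), (1, 0), (0, 1), (1, 1)} = 1 := by decide

/-- Sanity: the L-tromino (a one-step polygon) has two blocks. [folklore] -/
example : blockCount {(0, 0), (1, 0), (0, 1)} = 2 := by decide

/-! ### The aligned-mesh Cardy predicate for word amplitudes -/

/-- **Aligned word Cardy with at most `k` blocks.** For every conformal rectangle `R` whose carrier
is the open polyomino of the `δ₀`-squares `s` (`polyominoCarrier`, literally the carrier hypothesis
of `CardyLatticePolygon`), whose four marks are `δ₀`-lattice points, and with `blockCount s ≤ k`,
the transfer-matrix word amplitudes along the ALIGNED meshes `δ₀ / N` converge to Cardy's value of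
the cross-ratio: `polygonWordAmplitude R (δ₀/N) → cardyFunction (crossRatio x)` as `N → ∞`, for
every uniformizing datum `(φ, x)` of `R`. Marks are arbitrary lattice boundary points (NOT only
corners). [folklore] -/
def AlignedWordCardy (k : ℕ) : Prop :=
  ∀ (R : ConformalRectangle) (δ₀ : ℝ) (s : Finset (ℤ × ℤ)), 0 < δ₀ →
    R.carrier = polyominoCarrier δ₀ s →
    (∀ i, ∃ m n : ℤ, R.pt i = (δ₀ : ℂ) * ((m : ℂ) + (n : ℂ) * Complex.I)) →
    blockCount s ≤ k →
    ∀ (φ : ConformalEquiv UpperHalfPlane.upperHalfPlaneSet R.carrier) (x : Fin 4 → ℝ),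
      R.IsUniformizing φ x →
      Tendsto (fun N : ℕ => polygonWordAmplitude R (δ₀ / N)) atTop
        (𝓝 (Literature.Probability.RandomPlanarGeometry.cardyFunction (crossRatio x)))

/-! ### The three statements of the line

Each statement is a precise `Prop`, restated VERBATIM by its registered `theorem stub_… := by sorry`
below (the only `sorry`s of the file) and aliased under the stub's short name in the
implementation-detail namespace `__Registered` (the hypotheses of `WordSewing_of`, admissible BY
NAME for the native skeleton audit — device of `Cruxes/PolyominoToJordan/Lines/birth.lean`);
`wordSewing_of_stubs` applies the composition to the three `stub_…` literally, which checks that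
statements, aliases and stubs agree. -/

/-- STATEMENT 1 — aligned meshes suffice (see `stub_alignedMeshReduction`). -/
def AlignedMeshReduction : Prop :=
  (∀ (R : ConformalRectangle) (δ₀ : ℝ) (s : Finset (ℤ × ℤ)), 0 < δ₀ →
      R.carrier = polyominoCarrier δ₀ s →
      (∀ i, ∃ m n : ℤ, R.pt i = (δ₀ : ℂ) * ((m : ℂ) + (n : ℂ) * Complex.I)) →
      ∀ (φ : ConformalEquiv UpperHalfPlane.upperHalfPlaneSet R.carrier) (x : Fin 4 → ℝ),
        R.IsUniformizing φ x →
        Tendsto (fun N : ℕ => bondDomainCrossingProb R (δ₀ / N)) atTop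
          (𝓝 (Literature.Probability.RandomPlanarGeometry.cardyFunction (crossRatio x)))) →
    CardyLatticePolygon

/-- STATEMENT 2 — wire sewing: arbitrary lattice marks on rectangles (see `stub_wireSewing`). -/
def WireSewing : Prop :=
  CardyRectangle → AlignedWordCardy 1

/-- STATEMENT 3 — width sewing: one more junction letter (see `stub_widthSewing`). -/
def WidthSewing : Prop :=
  CardyOneStep → ∀ k : ℕ, 1 ≤ k → AlignedWordCardy k → AlignedWordCardy (k + 1)

/-! ### The registered stubs `stub_…` (the only `sorry`s of the file) -/

/-- **STUB 1 — aligned meshes suffice** (M; RSW technology, word-free). If for every marked lattice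
polygon `R` (carrier `polyominoCarrier δ₀ s`, `δ₀`-lattice marks) the G02 crossing probabilities
converge ALONG THE ALIGNED MESHES, `bondDomainCrossingProb R (δ₀/N) → cardyFunction η(R)` as
`N → ∞`, then `CardyLatticePolygon` holds (convergence along all `δ → 0⁺`).
Why plausibly true: for `δ → 0⁺` put `N = ⌊δ₀/δ⌋`, `c = δ₀/(N δ) → 1`; the G02 discretisation
(`meshDomain`, `discreteArc`: `δ·x ∈ Ω` and `infDist` comparisons) is exactly covariant under
`(Ω, marks, δ) ↦ (cΩ, c·marks, cδ)`, so `P_δ(R) = P_{δ₀/N}(cR)`; and crossing probabilities of the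
dilates `cR`, `c → 1`, of a lattice polygon are close to those of `R` UNIFORMLY in small meshes
(Schramm–Smirnov 2011 Lemma 5.1 / Bollobás–Riordan Ch. 7 sandwich: deterministic inclusions of G02
crossing events between `R` and longer–thinner / wider–shorter comparison quads, all landed in
`Theorems/CardyBoundaryCoulombGasRectilinearSuffices*.lean` and re-used by
`LatticePolygonApproximation.cardyFormulaZ2_of_cardyLatticePolygon`; Radó continuity of the
cross-ratio `ConformalRectangle.tendsto_crossRatio_of_tendsto_mark`). Size M.
[cite: SchrammSmirnov2011, Lemma 5.1 p. 21] [cite: BollobasRiordan2006, Ch. 7 Lemma 14 p. 184] -/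
theorem stub_alignedMeshReduction :
    (∀ (R : ConformalRectangle) (δ₀ : ℝ) (s : Finset (ℤ × ℤ)), 0 < δ₀ →
        R.carrier = polyominoCarrier δ₀ s →
        (∀ i, ∃ m n : ℤ, R.pt i = (δ₀ : ℂ) * ((m : ℂ) + (n : ℂ) * Complex.I)) →
        ∀ (φ : ConformalEquiv UpperHalfPlane.upperHalfPlaneSet R.carrier) (x : Fin 4 → ℝ),
          R.IsUniformizing φ x →
          Tendsto (fun N : ℕ => bondDomainCrossingProb R (δ₀ / N)) atTop
            (𝓝 (Literature.Probability.RandomPlanarGeometry.cardyFunction (crossRatio x)))) →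
      CardyLatticePolygon := by
  sorry

/-- **STUB 2 — wire sewing** (L–XL; the two-star WIRE letters of the crux's "why it might fail").
Cardy's formula for corner-marked rectangles (`CardyRectangle`: the length-one words
`⟨β|T_S^m|α⟩`, fully wired bottom row) implies aligned word Cardy for ALL lattice rectangles with
ARBITRARY `δ₀`-lattice marks (`AlignedWordCardy 1`; a Jordan polyomino with one row-block is a
lattice rectangle): marks on the horizontal sides are partially wired boundary states `α_A`,
read-outs `β_B`; marks on the vertical sides are rows where the wire letters start/stop, i.e. words
`⟨β_B| T''^{m₃} T'^{m₂} T^{m₁} |α_A⟩` in boundary-condition-changed strip transfer matrices.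
Why plausibly true: continuum limit = insertion of Cardy's boundary-condition-changing operator
`φ_{1,3}` (`h = 1/3`) at the marks on the sides of the strip — Cardy's original derivation, with the
corner-marked rectangle data (TL(`β=1`)/XXZ(`Δ=-1/2`) conformal towers `x ∈ {0, 1/3, 1, 4/3, 2,…}`
and boundary-state overlaps, BJS rectangular amplitudes) as normalisation; exactly the one-strip
("no width junction") sector of the sewing programme. It may fail where the crux may: side marks
see boundary-condition-changed sectors that corner data do not normalise. Size L–XL.
[cite: Cardy1992, eq. (8)] [cite: BondesanJacobsenSaleur2012, §5] [cite: Cardy2001, §7.1] -/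
theorem stub_wireSewing : CardyRectangle → AlignedWordCardy 1 := by
  sorry

/-- **STUB 3 — width sewing, one junction letter at a time** (XL; load-bearing; the "Z-words with
2+ junctions need junction limits in ALL TL sectors" clause of the crux's "why it might fail").
Given Cardy's formula for corner-marked one-step polygons (`CardyOneStep`: the route's ONE new
datum, the width-junction vertex in the boundary-visible even sector), aligned word Cardy for all
marked lattice polygons with at most `k ≥ 1` row-blocks and ARBITRARY lattice marks implies it for
at most `k + 1` row-blocks: cut the `(k+1)`-block word at its top width junction `J_{S,S'}`,
`⟨β| W_top J W_{≤k} |α⟩ = Σ_π (α W_{≤k} J)(π) (W_top β)(π)`; in the continuum the sum over row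
states becomes a sum over scaling states of the strip, the `≤ k`-block hypothesis with arbitrary
marks controls the overlaps of `α W_{≤k}` with every boundary-condition sector, `CardyOneStep`
calibrates the junction vertex, and conformal covariance of the vertex (Schwarz–Christoffel step
map, item 5275 `StepMapVertex`) with `ℓ¹` tails uniform in the width (item 5237
`JunctionOverlapLimit`) composes them to `cardyFunction (η)` of the `(k+1)`-block polygon.
Why it might fail: junction-overlap limits may fail to converge summably (c = 0 Jordan cells at
the `3π/2` corners) or the even-sector datum may not determine the odd sectors. Size XL.
[cite: BondesanJacobsenSaleur2012, §5] [cite: DubailStephan2011, eq. (4)]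
[cite: Cardy2001, §7.1] -/
theorem stub_widthSewing :
    CardyOneStep → ∀ k : ℕ, 1 ≤ k → AlignedWordCardy k → AlignedWordCardy (k + 1) := by
  sorry

/-! ### Name-keyed aliases of the three statements (the hypotheses of the composition) -/
namespace __Registered

/-- Alias of `AlignedMeshReduction` keyed by the registered stub name. -/
abbrev stub_alignedMeshReduction : Prop := AlignedMeshReduction
/-- Alias of `WireSewing` keyed by the registered stub name. -/
abbrev stub_wireSewing : Prop := WireSewing
/-- Alias of `WidthSewing` keyed by the registered stub name. -/
abbrev stub_widthSewing : Prop := WidthSewing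

end __Registered

/-! ### The composition (kernel-checked, no `sorry`) -/

/-- **Assembly** (kernel-checked, no `sorry`): aligned-mesh reduction, wire sewing and width sewing
imply the crux `CardyPolygonWords.WordSewing`. Given `CardyRectangle` and `CardyOneStep`:
`AlignedWordCardy k` for every `k ≥ 1` by induction on `k` (base: wire sewing; step: width sewing);
a marked lattice polygon `(R; δ₀, s)` has `blockCount s ≤ blockCount s + 1`, so its word amplitudes
converge along the aligned meshes; by the PROVED dictionary `RowTransferExactness_holds` these are,
for `N ≥ 1`, the G02 crossing probabilities `bondDomainCrossingProb R (δ₀/N)`; the aligned-mesh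
reduction then yields `CardyLatticePolygon`. [folklore] -/
theorem WordSewing_of (h₁ : __Registered.stub_alignedMeshReduction)
    (h₂ : __Registered.stub_wireSewing) (h₃ : __Registered.stub_widthSewing) :
    Summit.CriticalPhenomena.CardyFormulaZ2.Theses.CardyPolygonWords.WordSewing := by
  intro hRect hStep
  -- every block count, by induction from the wire-sewn rectangles
  have hall : ∀ k : ℕ, 1 ≤ k → AlignedWordCardy k := by
    intro k hk
    induction k, hk using Nat.le_induction with
    | base => exact h₂ hRect
    | succ k hk ih => exact h₃ hStep k hk ih
  -- aligned meshes suffice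
  refine h₁ ?_
  intro R δ₀ s hδ₀ hcar hmk φ x hux
  -- the word amplitudes of `(R; δ₀, s)` converge along the aligned meshes …
  have hword : Tendsto (fun N : ℕ => polygonWordAmplitude R (δ₀ / N)) atTop
      (𝓝 (Literature.Probability.RandomPlanarGeometry.cardyFunction (crossRatio x))) :=
    hall (blockCount s + 1) (Nat.succ_pos _) R δ₀ s hδ₀ hcar hmk (Nat.le_succ _) φ x hux
  -- … and they ARE the crossing probabilities for `N ≥ 1` (row-transfer exactness, proved)
  refine hword.congr' ?_
  filter_upwards [eventually_gt_atTop 0] with N hN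
  exact (RowTransferExactness_holds R δ₀ s N hδ₀ hN hcar).symm

/-- The composition applied to the three registered stubs LITERALLY (checks that the stub
statements and the hypotheses of `WordSewing_of` agree; its axiom closure contains `sorryAx`
exactly through the three stubs — it is NOT a proof of the item). [folklore] -/
theorem wordSewing_of_stubs :
    Summit.CriticalPhenomena.CardyFormulaZ2.Theses.CardyPolygonWords.WordSewing :=
  WordSewing_of stub_alignedMeshReduction stub_wireSewing stub_widthSewing

end Summit.CriticalPhenomena.CardyFormulaZ2.Cruxes.WordSewing.Birth

end
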